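import Summits.CriticalPhenomena.CardyFormulaZ2.Theorems.CardyFlipRussoVoronoiHubFromSmirnovDefs

/-!
# Stub `inCircle_iff_crossRatio_im` of line `moebius-exact-delaunay-dilation-ward`
# (crux `VoronoiHubFromSmirnov`, stmt-CriticalPhenomena-6433)

The IN-CIRCLE TEST of planar Delaunay geometry as the sign of a cross-ratio.  For three distinct
points `a, b, c` on the circle of radius `R` about `o` and any `d : ℂ`, with the cross-ratio
`CR(a,b,c,d) = (a − c)(b − d) / ((a − d)(b − c))` and the orientation
`orient(a,b,c) = Im (conj (b − a) · (c − a))` (`> 0` iff `a, b, c` are counter-clockwise):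

* `dist d o < R ↔ 0 < Im CR · orient(a,b,c)`   (d is strictly inside the circle through a, b, c);
* `dist d o = R ↔ Im CR = 0`                    (d is on that circle: a, b, c, d concyclic).

This is the elementary bridge used when transporting the Delaunay graph of a point configuration
(empty circumscribed disc rule) by a conformal map, where the same cross-ratio is controlled
(I. Benjamini, O. Schramm, *Conformal invariance of Voronoi percolation*, Comm. Math. Phys. 197
(1998), §4).  The proof is pure algebra: after translating to `o = 0`,
`Im CR = Im((a−c)(b−d)·conj((a−d)(b−c))) / |(a−d)(b−c)|²`, and for `|a| = |b| = |c| = R` the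
polynomial identity
`Im((a−c)(b−d)·conj((a−d)(b−c))) = (|d|² − R²) · Im((a−c)·conj(b−c))`
holds, while `Im((a−c)·conj(b−c)) = −orient(a,b,c) ≠ 0` for three distinct concyclic points.
The degenerate position `d = a` (where Lean's `x / 0 = 0` makes `CR = 0`) is consistent with both
clauses and is treated separately.

No new definitions.
-/

noncomputable section

namespace Summit.CriticalPhenomena.CardyFormulaZ2.Cruxes.VoronoiHubFromSmirnov.MoebiusExactDelaunayDilationWard

open ComplexConjugate

/-- Imaginary part of a quotient through the conjugate of the denominator:
`Im (z / w) = Im (z · conj w) / |w|²`. -/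
theorem icr_div_im (z w : ℂ) : (z / w).im = (z * conj w).im / Complex.normSq w := by
  rw [Complex.div_im, Complex.mul_im, Complex.conj_re, Complex.conj_im]
  ring

/-- The auxiliary quantity `Im((a − c)·conj(b − c))` is minus the orientation
`Im(conj(b − a)·(c − a))` of the triangle `(a, b, c)`. -/
theorem icr_imP_eq_neg_orient (a b c : ℂ) :
    ((a - c) * conj (b - c)).im = -(conj (b - a) * (c - a)).im := by
  simp only [Complex.mul_im, Complex.sub_re, Complex.sub_im, Complex.conj_re, Complex.conj_im]
  ring

/-- **Key polynomial identity.** For `a, b, c` on the circle `|z| = R` (centre `0`) and any `d`,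
`Im((a − c)(b − d)·conj((a − d)(b − c))) = (|d|² − R²) · Im((a − c)·conj(b − c))`. -/
theorem icr_key (a b c d : ℂ) (R : ℝ) (ha : a.re ^ 2 + a.im ^ 2 = R ^ 2)
    (hb : b.re ^ 2 + b.im ^ 2 = R ^ 2) (hc : c.re ^ 2 + c.im ^ 2 = R ^ 2) :
    ((a - c) * (b - d) * conj ((a - d) * (b - c))).im =
      (d.re ^ 2 + d.im ^ 2 - R ^ 2) * ((a - c) * conj (b - c)).im := by
  simp only [Complex.mul_im, Complex.mul_re, Complex.sub_re, Complex.sub_im, Complex.conj_re,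
    Complex.conj_im]
  linear_combination
    ((b.re * c.im - b.im * c.re) + d.re * (b.im - c.im) - d.im * (b.re - c.re)) * ha
    + (-(a.re * c.im - a.im * c.re) + d.re * (c.im - a.im) - d.im * (c.re - a.re)) * hb
    + ((a.re * b.im - a.im * b.re) + d.re * (a.im - b.im) - d.im * (a.re - b.re)) * hc

/-- Three DISTINCT points of the circle `|z| = R` are not collinear:
`Im((a − c)·conj(b − c)) ≠ 0`.  (From `|a| = |b| = |c| = R` one gets
`P · conj a = conj P · conj b` for `P = (a − c)·conj(b − c)`; if `P` were real this forces
`P · conj (a − b) = 0`.) -/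
theorem icr_imP_ne_zero {a b c : ℂ} {R : ℝ} (hab : a ≠ b) (hbc : b ≠ c) (hac : a ≠ c)
    (ha : a * conj a = (R : ℂ) ^ 2) (hb : b * conj b = (R : ℂ) ^ 2)
    (hc : c * conj c = (R : ℂ) ^ 2) : ((a - c) * conj (b - c)).im ≠ 0 := by
  intro h0
  have hreal := Complex.conj_eq_iff_im.mpr h0
  simp only [map_mul, map_sub, Complex.conj_conj] at hreal
  have hE : (a - c) * (conj b - conj c) * conj a = (conj a - conj c) * (b - c) * conj b := by
    linear_combination (conj b - conj c) * ha + (conj c - conj a) * hb + (conj a - conj b) * hc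
  have h3 : (a - c) * (conj b - conj c) * (conj a - conj b) = 0 := by
    linear_combination hE + conj b * hreal
  rcases mul_eq_zero.mp h3 with h | h
  · rcases mul_eq_zero.mp h with h | h
    · exact hac (sub_eq_zero.mp h)
    · exact hbc (by simpa using congrArg conj (sub_eq_zero.mp h))
  · exact hab (by simpa using congrArg conj (sub_eq_zero.mp h))

/-- The in-circle test, centre `0`: for distinct `a, b, c` with `|a| = |b| = |c| = R` and any `d`,
`|d| < R ↔ 0 < Im CR · orient(a,b,c)` and `|d| = R ↔ Im CR = 0`, where
`CR = (a − c)(b − d)/((a − d)(b − c))`. -/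
theorem icr_core (a b c d : ℂ) (R : ℝ) (hab : a ≠ b) (hbc : b ≠ c) (hac : a ≠ c)
    (ha : ‖a‖ = R) (hb : ‖b‖ = R) (hc : ‖c‖ = R) :
    (‖d‖ < R ↔ 0 < ((a - c) * (b - d) / ((a - d) * (b - c))).im * (conj (b - a) * (c - a)).im) ∧
    (‖d‖ = R ↔ ((a - c) * (b - d) / ((a - d) * (b - c))).im = 0) := by
  have hR : 0 ≤ R := ha ▸ norm_nonneg a
  have circ : ∀ x : ℂ, ‖x‖ = R → x.re ^ 2 + x.im ^ 2 = R ^ 2 := fun x hx => by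
    rw [← hx, Complex.sq_norm, Complex.normSq_apply]; ring
  have circ' : ∀ x : ℂ, ‖x‖ = R → x * conj x = (R : ℂ) ^ 2 := fun x hx => by
    rw [Complex.mul_conj, Complex.normSq_eq_norm_sq, hx]; push_cast; rfl
  have hPim : ((a - c) * conj (b - c)).im ≠ 0 :=
    icr_imP_ne_zero hab hbc hac (circ' a ha) (circ' b hb) (circ' c hc)
  have hO : (conj (b - a) * (c - a)).im ≠ 0 := by
    rw [icr_imP_eq_neg_orient] at hPim
    exact fun h => hPim (by rw [h, neg_zero])
  rcases eq_or_ne d a with hda | hda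
  · subst hda
    constructor <;> simp [ha]
  have hden : (a - d) * (b - c) ≠ 0 :=
    mul_ne_zero (sub_ne_zero.mpr (Ne.symm hda)) (sub_ne_zero.mpr hbc)
  have hn : 0 < Complex.normSq ((a - d) * (b - c)) := Complex.normSq_pos.mpr hden
  have hd2 : d.re ^ 2 + d.im ^ 2 = ‖d‖ ^ 2 := by
    rw [Complex.sq_norm, Complex.normSq_apply]; ring
  have him : ((a - c) * (b - d) / ((a - d) * (b - c))).im =
      (‖d‖ ^ 2 - R ^ 2) * ((a - c) * conj (b - c)).im / Complex.normSq ((a - d) * (b - c)) := by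
    rw [icr_div_im, icr_key a b c d R (circ a ha) (circ b hb) (circ c hc), hd2]
  refine ⟨?_, ?_⟩
  · have e : (‖d‖ ^ 2 - R ^ 2) * ((a - c) * conj (b - c)).im / Complex.normSq ((a - d) * (b - c)) *
          (conj (b - a) * (c - a)).im =
        (R ^ 2 - ‖d‖ ^ 2) *
          ((conj (b - a) * (c - a)).im ^ 2 / Complex.normSq ((a - d) * (b - c))) := by
      rw [icr_imP_eq_neg_orient]; ring
    rw [him, e, mul_pos_iff_of_pos_right (div_pos (sq_pos_iff.mpr hO) hn), sub_pos,
      sq_lt_sq₀ (norm_nonneg d) hR]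
  · rw [him, div_eq_zero_iff, mul_eq_zero, sub_eq_zero, sq_eq_sq₀ (norm_nonneg d) hR,
      or_iff_left hn.ne', or_iff_left hPim]

/-- **In-circle test as the sign of a cross-ratio.**  For three distinct points `a, b, c` on the
circle of radius `R` about `o` and any `d : ℂ`, with `CR = (a − c)(b − d)/((a − d)(b − c))` and
`orient(a,b,c) = Im(conj(b − a)·(c − a))`:
`dist d o < R ↔ 0 < Im CR · orient(a,b,c)` and `dist d o = R ↔ Im CR = 0`. -/
theorem inCircle_iff_crossRatio_im : ∀ (a b c d o : ℂ) (R : ℝ), a ≠ b → b ≠ c → a ≠ c → dist a o = R → dist b o = R → dist c o = R → (dist d o < R ↔ 0 < ((a - c) * (b - d) / ((a - d) * (b - c))).im * (starRingEnd ℂ (b - a) * (c - a)).im) ∧ (dist d o = R ↔ ((a - c) * (b - d) / ((a - d) * (b - c))).im = 0) := by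
  intro a b c d o R hab hbc hac ha hb hc
  rw [Complex.dist_eq] at ha hb hc
  have h := icr_core (a - o) (b - o) (c - o) (d - o) R
    (by simpa only [ne_eq, sub_left_inj] using hab) (by simpa only [ne_eq, sub_left_inj] using hbc)
    (by simpa only [ne_eq, sub_left_inj] using hac) ha hb hc
  simpa only [sub_sub_sub_cancel_right, Complex.dist_eq] using h

end Summit.CriticalPhenomena.CardyFormulaZ2.Cruxes.VoronoiHubFromSmirnov.MoebiusExactDelaunayDilationWard

end
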